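import Summits.CriticalPhenomena.SAWScalingLimit.Theorems.SAWRenewalTightnessRoomPassageDefs
import Literature.Probability.LatticeModels.FermionicObservable
import HarnessLib

/-!
# Objects of the line `parafermionic-martingale` for the crux `SubseqIdentification`
(stmt-CriticalPhenomena-0783; route `SAWTwistedSelfEnergy`; lead prover c6, crux protocol; skeleton
`Summits/CriticalPhenomena/SAWScalingLimit/Cruxes/SubseqIdentification/Lines/parafermionic_martingale.lean`)

The line runs the classical martingale-observable road (Lawler–Schramm–Werner, Smirnov,
Chelkak–Duminil-Copin–Hongler–Kemppainen–Smirnov) with the route's own observable — the spin-`5/8`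
parafermion of Duminil-Copin–Smirnov — as the EXACT exploration martingale of the critical `δℤ²`
self-avoiding walk of a Dobrushin domain `(D; a, b)`. This file holds ONLY THE OBJECTS, written
verbatim as the registered stub signatures of the line use them; no statement of the line is asserted
here (companion of `Theorems/SAWRenewalTightnessRoomPassageDefs.lean`, whose `prefixAt` / `capTimeOf`
it reuses).

Lattice side (`Ω_δ = discreteDomainGraph Ω δ`, weights `x_c^{|ω|}`, `x_c = SAW.criticalFugacity`):
* `contObs Ω δ a' l z` — `A(l, z)`, the parafermionic observable of the slit domain `Ω_δ ∖ l` from the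
  tip of the past `l` to `z`: sum over self-avoiding continuations `ω` meeting `l` only at the tip, weight
  `x_c^{|ω|} exp(-i (5/8) W)`, `W` the total winding (`LatticeModels.winding`, sum of turning angles) of the
  polyline `a' → l → ω`, phases continued from the fictitious incoming step `a' → a`;
* `contPartition Ω δ l b` — `B(l)`, the unphased partition function of continuations from the tip to `b`
  (so that `P(γ ⊒ l) = x_c^{|l|} B(l)/B(nil)`, domain Markov property);
* `pastObs Ω δ a' b l z = A(l, z)/B(l)` — `M(l, z)`, the observable of the slit domain rooted at its tip;
* `paraDoob D δ a a' b z γ n = M(γ[0,n], z)/M(γ[0,0], z)` — `Q_n`, the Doob-normalised observable along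
  the exploration (`Q_0 = 1`);
* `IsRootedApprox D a a' b` — an endpoint approximation whose source `a_δ` is, for all small meshes,
  `ℤ²`-adjacent to a lattice point `a'_δ` outside `D` (the root / phase reference).

Continuum side (`g_K = hydroFun K`, `g_t = Loewner.map W t`):
* `hullParaObs K ξ w = (w² g_K'(w)/(g_K(w) - ξ)²)^{5/8}` and `paraObs W w t = (w² g_t'(w)/(g_t(w) - W_t)²)^{5/8}`,
  both written `exp((5/8)(2 Log w + Log g' - 2 Log(g - ξ)))` with principal logarithms (the branch
  continuous from `1` in the capped regime);
* `paraObsCap W w u = paraObs W w (u ∧ (Im w)²/16)` — the time-capped observable (CDHKS deterministic cap,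
  `capTimeOf`).

Sanity lemmas: `hullParaObs_of_id` (`N(K, 0, w) = 1` where `g_K` is the identity to first order) and
`paraDoob_zero` (`Q_0 = 1`).

Sources: H. Duminil-Copin, S. Smirnov, Ann. of Math. 175 (2012) §2 (the parafermionic observable,
`σ = 5/8`) and §4 Conjecture 2; G. F. Lawler, O. Schramm, W. Werner, Proc. Sympos. Pure Math. 72 (2004)
§3.4 (the critical SAW measure, domain Markov property); D. Chelkak, H. Duminil-Copin, C. Hongler,
A. Kemppainen, S. Smirnov, C. R. Math. 352 (2014) §3 (exploration martingales, deterministic time cap).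
What is NOT here: the statements S1–S5 of the line (they live in the skeleton and, once proved, in
`Theorems/SAWTwistedSelfEnergySubseqIdentification*.lean`).
-/

noncomputable section

open MeasureTheory Filter Topology Set
open scoped NNReal ENNReal Classical BigOperators
open Literature.Probability.LatticeModels
open Literature.Probability.RandomPlanarGeometry
open UpperHalfPlane (upperHalfPlaneSet)

namespace Summit.CriticalPhenomena.SAWScalingLimit.Theorems.SubseqIdentification.ParaMartingale

open Summit.CriticalPhenomena.SAWScalingLimit.Theorems.SubseqIdentification.RoomEntropy
  (prefixAt capTimeOf)

/-! ## Lattice side: the parafermionic observable of a slit domain and its Doob normalisation -/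

section Lattice

variable (Ω : Set ℂ) (δ : ℝ)

/-- `A(l, z)`: the spin-`5/8` **parafermionic observable of the slit domain `Ω_δ ∖ l`** from the tip `v`
of the past `l` to the vertex `z` — the sum over self-avoiding continuations `ω : v → z` of `Ω_δ` meeting
`l` only at `v` of `x_c^{|ω|} exp(-i (5/8) W)`, `W` the total winding of the polyline `a' → l → ω`
(phases continued from the fictitious incoming step `a' → a`; vertex version of the Duminil-Copin–Smirnov
observable with `σ = 5/8`). [cite: DuminilCopinSmirnov2012, §2] -/
def contObs (a' : Site 2) {a v : Site 2} (l : (discreteDomainGraph Ω δ).Walk a v) (z : Site 2) : ℂ :=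
  ∑' ω : SAW.DomainSAW Ω δ v z,
    if ∀ u ∈ ω.walk.support.tail, u ∉ l.support then
      (SAW.criticalFugacity : ℂ) ^ ω.length *
        Complex.exp (-Complex.I * (5 / 8 : ℂ) *
          (winding (meshPoint δ a' :: ((l.append ω.walk).support.map (meshPoint δ))) : ℝ))
    else 0

/-- `B(l)`: the (unphased) **critical partition function of self-avoiding continuations** of the past
`l` from its tip to `b` inside `Ω_δ ∖ l` — so that `SAW.law {γ | γ ⊒ l} = x_c^{|l|} B(l)/B(nil)` (domain
Markov property of the weights `x_c^{|γ|}`). [cite: LawlerSchrammWerner2004SAW, §3.4.2] -/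
def contPartition {a v : Site 2} (l : (discreteDomainGraph Ω δ).Walk a v) (b : Site 2) : ℝ :=
  ∑' ω : SAW.DomainSAW Ω δ v b,
    if ∀ u ∈ ω.walk.support.tail, u ∉ l.support then SAW.criticalFugacity ^ ω.length else 0

/-- `M(l, z) = A(l, z)/B(l)`: the observable of the slit domain rooted at the tip, normalised by the
partition function of continuations to `b` (junk `0` if `B(l) = 0`, Lean's `x / 0 = 0`).
[cite: DuminilCopinSmirnov2012, §4 Conjecture 2] -/
def pastObs (a' b : Site 2) {a v : Site 2} (l : (discreteDomainGraph Ω δ).Walk a v) (z : Site 2) : ℂ :=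
  contObs Ω δ a' l z / (contPartition Ω δ l b : ℂ)

end Lattice

/-- `Q_n(γ, z) = M(γ[0,n], z)/M(γ[0,0], z)`: the **Doob-normalised parafermionic observable along the
exploration** of the SAW `γ` of `(D; a, b)` at mesh `δ` (deterministic normalisation by the time-`0`
value, so `Q_0 = 1` whenever `M(γ[0,0], z) ≠ 0`; junk `0` otherwise). [folklore] -/
def paraDoob (D : DobrushinDomain) (δ : ℝ) (a a' b z : Site 2) (γ : SAW.DomainSAW D.carrier δ a b)
    (n : ℕ) : ℂ :=
  pastObs D.carrier δ a' b (prefixAt γ n) z / pastObs D.carrier δ a' b (prefixAt γ 0) z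

/-- **Rooted endpoint approximation**: an endpoint approximation `(a_δ, b_δ)` of `(D; a, b)` whose source
`a_δ` is, for all small meshes, adjacent in `ℤ²` to a lattice point `a'_δ` whose mesh point lies OUTSIDE
`D` (the root: it fixes the phase reference of the observable and puts the tip of every slit domain
`Ω_δ ∖ γ[0,n]` on its outer boundary). [cite: DuminilCopinSmirnov2012, §4 Conjecture 2] -/
def IsRootedApprox (D : DobrushinDomain) (a a' b : ℝ → Site 2) : Prop :=
  SAW.IsEndpointApprox D a b ∧
    ∀ᶠ δ in 𝓝[>] (0 : ℝ), (zdGraph 2).Adj (a δ) (a' δ) ∧ meshPoint δ (a' δ) ∉ D.carrier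

/-! ## Continuum side: the weight-`5/8` observable of a hull and along a driver -/

/-- `N(K, ξ, w) = (w² g_K'(w)/(g_K(w) - ξ)²)^{5/8}`, written
`exp((5/8)(2 Log w + Log g_K'(w) - 2 Log (g_K(w) - ξ)))` with PRINCIPAL logarithms (`g_K = hydroFun K`,
the hydrodynamically normalised map off the half-plane hull `K`; real base point `ξ`). At `K = ∅`,
`ξ = 0` it is `1`. [cite: LawlerSchrammWerner2004SAW, §4.1] -/
def hullParaObs (K : Set ℂ) (ξ : ℝ) (w : ℂ) : ℂ :=
  Complex.exp ((5 / 8 : ℂ) *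
    (2 * Complex.log w + Complex.log (deriv (hydroFun K) w) - 2 * Complex.log (hydroFun K w - ξ)))

/-- `N_t(w) = (w² g_t'(w)/(g_t(w) - W_t)²)^{5/8}` along the chordal Loewner chain of the driver `W` (same
branches; `g_t = Loewner.map W t`): the conjectured scaling limit of `Q_n`; far field
`1 + (5/4) W_t/w + (45/32)(W_t² - (8/3) t)/w² + O(w⁻³)`. [cite: LawlerSchrammWerner2004SAW, §4.1] -/
def paraObs (W : ℝ≥0 → ℝ) (w : ℂ) (t : ℝ≥0) : ℂ :=
  Complex.exp ((5 / 8 : ℂ) *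
    (2 * Complex.log w + Complex.log (deriv (Loewner.map W t) w) - 2 * Complex.log (Loewner.map W t w - W t)))

/-- The **time-capped** observable `N_{u ∧ (Im w)²/16}(w)` (deterministic cap `capTimeOf w = (Im w)²/16`,
as in the room line: up to that time every continuous driver keeps `w` at height `≥ (√3/2) Im w`).
[cite: CDHKSCRAS2014, §3] -/
def paraObsCap (W : ℝ≥0 → ℝ) (w : ℂ) (u : ℝ≥0) : ℂ :=
  paraObs W w (min u (capTimeOf w))

/-! ## Trivial API (sanity of the vocabulary) -/

/-- The hull functional with base point `0` is `1` wherever `hydroFun K` fixes `w` with derivative `1`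
(e.g. the empty hull): the time-`0` value of the continuum observable, matching `Q_0 = 1`. [folklore] -/
theorem hullParaObs_of_id {K : Set ℂ} {w : ℂ} (h1 : hydroFun K w = w) (h2 : deriv (hydroFun K) w = 1) :
    hullParaObs K 0 w = 1 := by
  simp [hullParaObs, h1, h2]

/-- `Q_0 = 1` whenever the time-`0` observable is non-degenerate. [folklore] -/
theorem paraDoob_zero {D : DobrushinDomain} {δ : ℝ} {a a' b z : Site 2} (γ : SAW.DomainSAW D.carrier δ a b)
    (h : pastObs D.carrier δ a' b (prefixAt γ 0) z ≠ 0) : paraDoob D δ a a' b z γ 0 = 1 := by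
  simp [paraDoob, div_self h]

/-- The capped observable agrees with the raw one up to the cap time. [folklore] -/
theorem paraObsCap_eq {W : ℝ≥0 → ℝ} {w : ℂ} {u : ℝ≥0} (hu : u ≤ capTimeOf w) :
    paraObsCap W w u = paraObs W w u := by
  rw [paraObsCap, min_eq_left hu]

/-! ## Lattice-rooted approximations (lead reshape r-c6-1)

The root clause of `IsRootedApprox` asks for a `ℤ²`-neighbour `a'_δ` of the source whose mesh point
lies outside the OPEN domain `D`. For a wild Jordan boundary (exterior fjords thinner than the mesh,
shielding islands of lattice points at every scale) no vertex of the discrete domain near `a` need have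
such a neighbour, so the existence statement S5 over `IsRootedApprox` is not provable from the tree's
plane topology. What the observable needs is only that the fictitious incoming step `a'_δ → a_δ` is NOT
an edge of the discrete domain `Ω_δ` (then no self-avoiding walk of `Ω_δ` from `a_δ` makes a U-turn at
its first step, so the winding of `a' → γ` is a continuous functional, and the missing edge certifies
that the complement of the discrete domain is `δ`-close to `a_δ`). This is `IsLatticeRooted`; it is
implied by `IsRootedApprox` (`isLatticeRooted_of_isRootedApprox`), so every statement quantified over
lattice-rooted approximations is formally STRONGER than its rooted form. -/

/-- **Lattice-rooted endpoint approximation**: an endpoint approximation `(a_δ, b_δ)` of `(D; a, b)`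
together with, for all small meshes, a `ℤ²`-neighbour `a'_δ` of the source `a_δ` such that `a'_δ a_δ` is
NOT an edge of the discrete domain `Ω_δ = discreteDomainGraph D δ` (either `a'_δ` is not a vertex of
`Ω_δ`, or the segment `[δ a'_δ, δ a_δ]` leaves `D̄`): the phase reference of the parafermionic observable.
[cite: DuminilCopinSmirnov2012, §4 Conjecture 2] -/
def IsLatticeRooted (D : DobrushinDomain) (a a' b : ℝ → Site 2) : Prop :=
  SAW.IsEndpointApprox D a b ∧
    ∀ᶠ δ in 𝓝[>] (0 : ℝ), (zdGraph 2).Adj (a δ) (a' δ) ∧ ¬ (discreteDomainGraph D.carrier δ).Adj (a δ) (a' δ)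

/-- A rooted approximation is lattice-rooted: a lattice point whose mesh point lies outside `D` is not a
mesh vertex, hence not in the discrete domain, hence not adjacent to anything in `Ω_δ`. [folklore] -/
theorem isLatticeRooted_of_isRootedApprox {D : DobrushinDomain} {a a' b : ℝ → Site 2}
    (h : IsRootedApprox D a a' b) : IsLatticeRooted D a a' b := by
  refine ⟨h.1, h.2.mono fun δ hδ => ⟨hδ.1, fun hadj => hδ.2 ?_⟩⟩
  have hmem : a' δ ∈ meshDomain D.carrier δ := (discreteDomainGraph_adj_iff.1 hadj).2.2
  exact (mem_meshVertices_iff).1 (meshDomain_subset_meshVertices _ _ hmem)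

end Summit.CriticalPhenomena.SAWScalingLimit.Theorems.SubseqIdentification.ParaMartingale

end
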